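import Literature.MathematicalPhysics.QuantumFieldTheory.Balaban1983to89.B6RandomWalkHom
import Literature.MathematicalPhysics.QuantumFieldTheory.Balaban1983to89.B9Thm34Ext
import Literature.MathematicalPhysics.QuantumFieldTheory.Balaban1983to89.B9SectDSup

/-!
# `Balaban1983to89.B9Thm312Whole` — [B9] Theorem 3.12 (p. 423) AS THE WHOLE PRINTED LEAF `B9.Thm312Printed`: the Sect.-D
# letters at one member, the three SHARED predicate pins (`HasRWExp`, `HasRWExpH`, `PosDefK`), and a glue module over the
# landed Sect.-D engines (`B9SectDSup`, `B11SectG`, `B9Thm37GlueCor36`)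

T. Bałaban, *Propagators for lattice gauge theories in a background field*, Commun. Math. Phys. **99** (1985) 389–434
[`Balaban1985BackgroundPropagators`, "B9"]; [4] = T. Bałaban, *Propagators and renormalization transformations for lattice
gauge theories. II*, Commun. Math. Phys. **96** (1984) 223–250 [`Balaban1984PropagatorsII`].

statement-level skeleton of published theorems with citation tags; proofs where landed; nothing here is a claim about the
Yang–Mills mass gap

THE PRINTED LOCI (verbatim, held text `paper:balaban1985-cmp99-background-propagators` pp. 420–423).  p. 421: *"Now we will
prove that Theorems 3.3, 3.10, 3.11 hold for the propagators G, G₁. This will be an immediate consequence of perturbative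
expansions we will construct. Let us denote for a moment the operator we have investigated in previous sections by G₀, i.e.
G₀ = (Δ + DRD* + Q*aQ)⁻¹. From (3.120) we get G = G₀(I − Δ′_πG₀)⁻¹ = Σ_{n=0}^∞ G₀(Δ′_πG₀)ⁿ. (3.130)"*; p. 422: *"This
inequality [(3.131)] and Theorem 3.3 for G₀ imply a convergence of the series (3.130), for α₀ sufficiently small, in all
norms appearing on the left-hand sides of the inequalities (3.42)–(3.47), except the inequality involving the Laplace
operator in (3.42). Thus we have Theorem 3.3. for G, with this exception. Of course Theorem 3.10 holds also because we
replace each operator in (3.130) by its random walk expansion."*; (3.126) p. 420: *"HB = GQ*(QGQ*)⁻¹B"*; (3.129) p. 421: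
*"H₁B = G₁Q*(QG₁Q*)⁻¹B"*; (3.138) p. 423: *"G₁ = G₀(I − (Δ′_π + Δ⁽²⁾_π)G₀)⁻¹ = Σ_{n=0}^∞ G₀((Δ′_π + Δ⁽²⁾_π)G₀)ⁿ"*;
p. 423: *"Theorem 3.12. If an external gauge field configuration U satisfies both regularity conditions (3.35), (3.36) for
α₀ sufficiently small, then Theorems 3.3, 3.10, 3.11 hold for the propagators G, G₁, with one exception and the inequality
(1.133) [sic: (3.133)] together with Theorem 3.10 hold for the operators H, H₁. The exception is the inequality in (3.42)
involving the covariant Laplace operator. It does not hold for G, G₁."*; p. 425 (3.147): *"𝔓 = I − G₁Q*(QG₁Q*)⁻¹Q −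
G₁DRD*"*, *"Verifying the above properties we need to know only the identities (3.124) and RD*G₁DR = R"*; p. 426 (3.153):
*"𝔊 = G₁ − G₁DRD*G₁ − G₁Q*(QG₁Q*)⁻¹QG₁ = G₁𝔓* = 𝔓G₁"*.

THE POINT.  The cell's typed skeleton `…Balaban1983to89.B9` carries Theorem 3.12 as `B9.Thm312Printed d c35 geo bg GD G₁ H H₁
HasRWExp HasRWExpH PosDefK` over FREE kernel families `GD G₁ : KernelFamily`, `H H₁ : HKernel` (readings of the printed
quantities (3.42)–(3.47), (3.133)) and three FREE predicates `HasRWExp`, `HasRWExpH`, `PosDefK` (*"Theorems 3.10, 3.11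
hold for …"*); at NODE 00's Stage-11 record they are free fields of def-Y's operator layer `B9PinCarriersKLevelV1.OperatorLayerY`,
so the obligation `t312` of the N06 knit (`…BalabanUVNodesN06AtRecord11CB10YZW.b9_main_of_up_view₁₁B10YZW_of_obligations`) is
junk-closable as long as the predicates are unpinned.  Meanwhile the tree PROVES the bookkeeping of the printed proof over
abstract block norms: `B11SectG.neumann_majorant` (the Neumann series over block majorants), `B9SectDSup` (r1-g7: the factored
series (3.130), `rightEntry_majorant`, rescaled norms `weightNorm`, the located smallness), `B9SectDL2Decay` (the L² half),
`B9SectDForm` (the form route to positivity), `B9FrakGPos` (adv8: the positivity reading of 𝔊 that is TRUE — on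
{A : QA = 0, RD*A = 0}), `B9Thm37GlueCor36` (the reading `CoRealizes` of a kernel family's sup entries by a model operator
and the typed clauses `Clause342`).  THIS FILE is the glue, in the pin pattern of `B9Thm37Whole` (n06-c):

* §1 `Ops g B X Y Z W` — THE SECT.-D LETTERS AT ONE MEMBER as functions of the background U (G₀, Δ_a = G₀⁻¹, Δ′_π, Δ⁽²⁾_π,
  G, G₁, 𝔊, ∇_U, ∇*_U, Q, Q*, (QGQ*)⁻¹, (QG₁Q*)⁻¹, H, H₁, the D, D*, R of DRD*) over four function lattices (X = coordinates
  of the 𝔤-valued bond fields A, Y = coordinates of ∇_UA, Z = coordinates of the coarse fields B = QA, W = coordinates of the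
  scalar site fields of D, R) with their block maps into 𝔅 — a PARAMETER RECORD, nothing constructed; `frakP`∕`frakPstar`
  ((3.147) and its transpose, from the letters).
* §2 THE THREE SHARED PINS (the SAME definitions serve `t312` and `t313`, since one operator layer carries one `HasRWExp`,
  one `PosDefK`): `PosDefKOfOps 𝔬` := «G(U) > 0, G₁(U) > 0 (positive definite forms), 𝔊(U) ≥ 0 and 𝔊(U) > 0 on
  {A : QA = 0, RD*A = 0}» — *"Theorem 3.11 holds for G, G₁"* and, for 𝔊, the REPAIRED reading of `B9FrakGPos` (the clause
  as printed is false: 𝔊Q* = 0); `HasRWExpOfOps 𝔬` := «the series (3.130), (3.138) CONVERGE, pointwise on the finite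
  lattice, to G(U), G₁(U), and 𝔓 applied to (3.138) converges to 𝔊(U)» — the located reading of *"Theorem 3.10 holds
  for G, G₁ [, 𝔊]"* = *"we replace each operator in (3.130) by its random walk expansion"* ∕ *"Replacing the operators in
  (3.138) by their random walk expansions we get a random walk expansion for G₁"* (the walks ω of the INSERTED expansions,
  tree-like by p. 427, are NOT modelled — the typed companion with walks is `B9SectDERandomWalkClauses.Thm312RWPrinted`;
  the rate argument of the slot is idle here: the decay lives in the (3.42) clauses of the leaf); `HasRWExpHOfOps 𝔬` :=
  «(3.126) ∕ (3.129) with (3.130) ∕ (3.138) inserted converge to H(U), H₁(U)».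
* §3 HYPOTHESIS SCHEMAS of printed shape (Prop structures; nothing asserted): `GeoOK` (d pseudo-metric, L^jη > 0),
  `Thm33G0` (Theorem 3.3 for G₀ at U: entries (3.42)₁ and (3.42)₃ as [4]-(2.51) block majorants), `Step` (THE PERTURBATION
  STEP K′ = G₀Δ′_π, K′₁ = G₀(Δ′_π + Δ⁽²⁾_π) with the block majorant θ·e^{−δ_K d} in the rescaled sup norm of weight
  (L^jη)^{−p} — p. 422 *"This inequality [(3.131)] and Theorem 3.3 for G₀ imply a convergence of the series (3.130)"*,
  matrix-level discharge = r06's `B9Thm312PositivityAssembled.hasMaj_G0_mul_step`), `FormSmall` (the relative form bound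
  |⟨A, Δ′_πA⟩|, |⟨A, (Δ′_π + Δ⁽²⁾_π)A⟩| ≦ r⟨A, Δ_aA⟩ — `B9SectDForm`'s (N′) — with Δ_a > 0 = Theorem 3.11 for Δ_a),
  `Identities` (the resolvent identities behind (3.130)∕(3.138): G₀Δ_a = Δ_aG₀ = I, (Δ_a − Δ′_π)G = I, …; (3.126), (3.129),
  (3.153); the p. 425 identities (3.124), RD*G₁DR = R, (QG₁Q*)(QG₁Q*)⁻¹ = I; Q* ∕ D* adjoint to Q ∕ D, R symmetric).
* THE THEOREMS are the sequel `…B9Thm312WholeLeaf` (kept apart so that this DEFINITION file stays short): §4 ONE MEMBER,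
  ONE U — `hasMaj_right_of_step` (the right entries G𝒳, G₁𝒳 with decay, `B9SectDSup.rightEntry_majorant` + the a-priori
  bound of the finite lattice), `entry0_of_step` ∕ `entry2_of_step` ((3.42)₁, (3.42)₃ for G and G₁ in the printed sup
  shapes), `seriesConv_of_step` (the remainder (G₀Δ′_π)ᴺG → 0, hence (3.130)∕(3.138) converge), `posDef_of_formSmall`
  (G, G₁ > 0), `GG_nonneg` ∕ `GG_pos_on_constraint` (dot-product twins of `B9FrakGPos`), and the pins inhabited:
  `posDefK_of_schemas`, `hasRWExp_of_schemas`, `hasRWExpH_of_schemas`;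
  §5 THE FAMILY: ★ `thm312Printed_of_step` — **THE WHOLE PRINTED LEAF** `B9.Thm312Printed d c35 geo bg GD G₁ H H₁
  (fun i => HasRWExpOfOps (𝔬 i)) (fun i => HasRWExpHOfOps (𝔬 i)) (fun i => PosDefKOfOps (𝔬 i))` for FREE kernel families
  `GD G₁ H H₁` (section variables of the `OperatorLayerY` field types) whose sup entries n = 0, 2 are CO-READ
  (`B9Thm37GlueCor36.CoRealizes`) by G(U), G(U)∇*_U, G₁(U), G₁(U)∇*_U — from, per member and per U under the printed
  provisos (M ≧ M₁, 0 < α₀, Mα₀ ≦ a₁, (3.35), (3.36)): the schemas of §3 with the step constant θ₁·(Mα₀) (*"each operator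
  Δ′_π provides the small factor α₀"*, p. 422) and the form constant r₁·(Mα₀); per member: `GeoOK`, [4] Lemma 2.1 (2.61) as
  `B11SectG.RowSum` for M ≧ M_L, the sign facts `B9FromB6ModelSignsOn.ModelSignsOn (geo i) (P i)` (ANY `P`; the Hölder
  monotonicity field is not used — dag-n06-d INTERFACE-1); and the RESIDUAL MEMBERS DISPLAYED as hypotheses of printed shape
  with uniform constants (B₁, δ₁, B(β), B′(ε), B′(ε,β)): the left sup entry (3.42)₂ (∇_UG, ∇_UG₁ — its proof needs the
  factored sup ⊕ Hölder state space of `B9SectDSup` THEOREM S), the Hölder block (3.43)–(3.45), the L² block (3.46)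
  (`B9SectDL2Decay`), the global block (3.47)₁₋₃, and (3.133) for H, H₁ (route: `B9Ineq3133Assembly.ineq3133_printed_sup ∕
  _holder`).  *"for α₀ sufficiently small"* is met with a₀ := min(a₁, (2D)⁻¹, (2r₁)⁻¹), D = θ₁c (q = θ₁(Mα₀)c ≦ ½).

HONEST SCOPE.  Nothing of print is asserted: Theorem 3.3 for G₀, the step majorants ((3.131) and its Δ⁽²⁾ twin (3.137)),
the form bound, Theorem 3.11 for Δ_a, the identities of pp. 420–426 and [4] Lemma 2.1 are HYPOTHESES of printed shape;
the residual members listed above are NOT proved here; the pins read *"Theorem 3.10 holds"* as convergence of the printed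
perturbation series (no walks) and *"Theorem 3.11 holds for 𝔊"* in `B9FrakGPos`' repaired sense.  Value: kernel-checked
bookkeeping — the printed leaf inhabited over the lineage's objects at explicit pins — NOT a node discharge, NOT summit
progress; one finite lattice at a time; nothing continuum, nothing about the mass gap.  Cell `pub-ymgap` (HUMAN RULING
D-0062), Track A node N06 [B9], N06-ASSIGNMENT v1 row 20, seat `pub-ymgap-dag-n06-l`, 2026-08-26.
-/

namespace Literature.MathematicalPhysics.QuantumFieldTheory.Balaban1983to89.B9Thm312Whole

open Literature.MathematicalPhysics.QuantumFieldTheory.Balaban1983to89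
open Finset Filter B6RandomWalk B6RandomWalkHom B9Thm34Ext B11SectG B9SectDSup
open _root_.Topology

noncomputable section

/-! ## §1 The Sect.-D letters at one member -/

section OneMember

variable {g : B9.Geometry} {B : B9.Backgrounds} {X Y Z W : Type}

/-- **THE LETTERS OF SECT. D AT ONE FAMILY MEMBER**, as total functions of the background configuration U, over four
function lattices: `X` = the real coordinates of the 𝔤-valued bond fields A (domain and range of G₀, G, G₁, 𝔊), `Y` = those
of ∇_UA, `Z` = those of the coarse fields B = QA, `W` = those of the scalar site fields of the operators D, R of `DRD*`;
`blk`, `blkY`, `blkZ`, `blkW` = their block maps into 𝔅 (x ↦ the y with x ∈ Δ(y)).  `G0 U` = G₀ = (Δ + DRD* + Q*aQ)⁻¹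
(p. 421; = Theorem 3.3's G); `S0 U` = Δ_a = G₀⁻¹ (Theorem 3.11); `Tpi U` = Δ′_π ((3.120)); `T2 U` = Δ⁽²⁾_π ((3.135));
`G U` = G = (Δ_π + DRD* + Q*aQ)⁻¹ ((3.122)); `G1 U` = G₁ ((3.128)); `GG U` = 𝔊 ((3.148)∕(3.153)); `D U` = ∇_U, `Dstar U` = ∇*_U
(the E- ∕ F-letters of (3.42)₂,₃); `Q U`, `Qstar U` = the averaging operator of (3.110) and its adjoint; `C U` = (QGQ*)⁻¹,
`C1 U` = (QG₁Q*)⁻¹ ((3.132)); `Hm U` = H ((3.126)), `H1m U` = H₁ ((3.129)); `Dv U`, `Dvstar U`, `R U` = the D, D*, R of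
DRD* ((3.17), (3.122)).  A PARAMETER RECORD — nothing is constructed or asserted (pattern of `B9Thm37Whole.Ops`,
`B9PinCarriersKLevelV1.OperatorLayerY`). [cite: Balaban1985BackgroundPropagators, (3.120)–(3.153) pp.419–426] -/
structure Ops (g : B9.Geometry) (B : B9.Backgrounds) (X Y Z W : Type) where
  blk : X → g.Site
  blkY : Y → g.Site
  blkZ : Z → g.Site
  blkW : W → g.Site
  G0 : B.Cfg → Module.End ℝ (X → ℝ)
  S0 : B.Cfg → Module.End ℝ (X → ℝ)
  Tpi : B.Cfg → Module.End ℝ (X → ℝ)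
  T2 : B.Cfg → Module.End ℝ (X → ℝ)
  G : B.Cfg → Module.End ℝ (X → ℝ)
  G1 : B.Cfg → Module.End ℝ (X → ℝ)
  GG : B.Cfg → Module.End ℝ (X → ℝ)
  D : B.Cfg → (X → ℝ) →ₗ[ℝ] (Y → ℝ)
  Dstar : B.Cfg → (Y → ℝ) →ₗ[ℝ] (X → ℝ)
  Q : B.Cfg → (X → ℝ) →ₗ[ℝ] (Z → ℝ)
  Qstar : B.Cfg → (Z → ℝ) →ₗ[ℝ] (X → ℝ)
  C : B.Cfg → Module.End ℝ (Z → ℝ)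
  C1 : B.Cfg → Module.End ℝ (Z → ℝ)
  Hm : B.Cfg → (Z → ℝ) →ₗ[ℝ] (X → ℝ)
  H1m : B.Cfg → (Z → ℝ) →ₗ[ℝ] (X → ℝ)
  Dv : B.Cfg → (W → ℝ) →ₗ[ℝ] (X → ℝ)
  Dvstar : B.Cfg → (X → ℝ) →ₗ[ℝ] (W → ℝ)
  R : B.Cfg → Module.End ℝ (W → ℝ)

/-- **𝔓 of (3.147)** from the letters: 𝔓 = I − G₁Q*(QG₁Q*)⁻¹Q − G₁DRD* (the module-level twin of `B9FrakGPos.frakP`).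
[cite: Balaban1985BackgroundPropagators, (3.147) p.425] -/
def frakP (𝔬 : Ops g B X Y Z W) (U : B.Cfg) : Module.End ℝ (X → ℝ) :=
  LinearMap.id - 𝔬.G1 U ∘ₗ 𝔬.Qstar U ∘ₗ 𝔬.C1 U ∘ₗ 𝔬.Q U - 𝔬.G1 U ∘ₗ 𝔬.Dv U ∘ₗ 𝔬.R U ∘ₗ 𝔬.Dvstar U

/-- **𝔓* of (3.153)** from the letters: 𝔓* = I − Q*(QG₁Q*)⁻¹QG₁ − DRD*G₁ (the module-level twin of `B9FrakGPos.frakPstar`).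
[cite: Balaban1985BackgroundPropagators, (3.153) p.426] -/
def frakPstar (𝔬 : Ops g B X Y Z W) (U : B.Cfg) : Module.End ℝ (X → ℝ) :=
  LinearMap.id - 𝔬.Qstar U ∘ₗ 𝔬.C1 U ∘ₗ 𝔬.Q U ∘ₗ 𝔬.G1 U - 𝔬.Dv U ∘ₗ 𝔬.R U ∘ₗ 𝔬.Dvstar U ∘ₗ 𝔬.G1 U

/-- Pointwise form of (3.147). [cite: Balaban1985BackgroundPropagators, (3.147) p.425] -/
theorem frakP_apply (𝔬 : Ops g B X Y Z W) (U : B.Cfg) (f : X → ℝ) :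
    frakP 𝔬 U f = f - 𝔬.G1 U (𝔬.Qstar U (𝔬.C1 U (𝔬.Q U f))) - 𝔬.G1 U (𝔬.Dv U (𝔬.R U (𝔬.Dvstar U f))) := rfl

/-- Pointwise form of 𝔓*. [cite: Balaban1985BackgroundPropagators, (3.153) p.426] -/
theorem frakPstar_apply (𝔬 : Ops g B X Y Z W) (U : B.Cfg) (f : X → ℝ) :
    frakPstar 𝔬 U f = f - 𝔬.Qstar U (𝔬.C1 U (𝔬.Q U (𝔬.G1 U f))) - 𝔬.Dv U (𝔬.R U (𝔬.Dvstar U (𝔬.G1 U f))) := rfl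

/-- **(3.153), the outer equality G₁𝔓* = 𝔓G₁** — pure algebra, no hypothesis (twin of `B9FrakGPos.g_comp_frakPstar`).
[cite: Balaban1985BackgroundPropagators, (3.153) p.426] -/
theorem G1_comp_frakPstar (𝔬 : Ops g B X Y Z W) (U : B.Cfg) : 𝔬.G1 U ∘ₗ frakPstar 𝔬 U = frakP 𝔬 U ∘ₗ 𝔬.G1 U := by
  ext f
  simp [frakP_apply, frakPstar_apply, map_sub]

/-! ## §2 The three shared pins -/

variable [Fintype X] [Fintype Z] [Fintype W]

/-- A POSITIVE DEFINITE operator on a finite function lattice (the meaning Theorem 3.11's proof fixes, p. 416: the form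
⟨f, Tf⟩ is positive for f ≠ 0). [cite: Balaban1985BackgroundPropagators, Thm 3.11 p.416] -/
def PosDefEnd (T : Module.End ℝ (X → ℝ)) : Prop :=
  ∀ f : X → ℝ, f ≠ 0 → 0 < f ⬝ᵥ T f

omit [Fintype Z] [Fintype W] in
/-- A positive definite operator has a non-negative form (the notion of Theorem 3.11, p. 416). [cite: Balaban1985BackgroundPropagators, Thm 3.11 p.416 (bookkeeping)] -/
theorem PosDefEnd.nonneg {A : Module.End ℝ (X → ℝ)} (h : PosDefEnd A) (f : X → ℝ) : 0 ≤ f ⬝ᵥ A f := by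
  by_cases hf : f = 0
  · simp [hf]
  · exact (h f hf).le

/-- **THE SERIES Σₙ G₀(TG₀)ⁿ CONVERGES TO `A`** (pointwise on the finite lattice): the partial sums Σ_{n<N}(G₀T)ⁿG₀f of
(3.130) (T = Δ′_π, A = G) ∕ (3.138) (T = Δ′_π + Δ⁽²⁾_π, A = G₁) tend to Af at every point.  (G₀(TG₀)ⁿ = (G₀T)ⁿG₀.)
[cite: Balaban1985BackgroundPropagators, (3.130) p.421 + (3.138) p.423] -/
def SeriesConv (G0 T A : Module.End ℝ (X → ℝ)) : Prop :=
  ∀ (f : X → ℝ) (x : X),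
    Tendsto (fun N : ℕ => (∑ n ∈ Finset.range N, ((G0 ∘ₗ T) ^ n) (G0 f)) x) atTop (𝓝 (A f x))

/-- **THE SERIES READ THROUGH A LEFT FACTOR `L` AND A RIGHT FACTOR `F`**: Σ_{n<N} L(G₀T)ⁿG₀(Fb) → A b pointwise — the
expansions of H = GQ*(QGQ*)⁻¹ ((3.126) with (3.130) inserted: L = I, F = Q*(QGQ*)⁻¹), of H₁ ((3.129) with (3.138)), and of
𝔊 = 𝔓G₁ ((3.153) with (3.138): L = 𝔓, F = I). [cite: Balaban1985BackgroundPropagators, (3.126) p.420, (3.129) p.421, (3.153) p.426, remark p.427] -/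
def SeriesConvLR {V : Type} (G0 T L : Module.End ℝ (X → ℝ)) (F : (V → ℝ) →ₗ[ℝ] (X → ℝ)) (A : (V → ℝ) →ₗ[ℝ] (X → ℝ)) :
    Prop :=
  ∀ (b : V → ℝ) (x : X),
    Tendsto (fun N : ℕ => L (∑ n ∈ Finset.range N, ((G0 ∘ₗ T) ^ n) (G0 (F b))) x) atTop (𝓝 (A b x))

/-- **THE PIN OF `PosDefK` — «Theorem 3.11 holds for the propagators G, G₁ [Thm 3.12], 𝔊 [Thm 3.13]»** at U, read on the
model operators of the letter record (the kernel-family argument is not read: one predicate serves both leaves, as one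
operator layer carries one `PosDefK`): G(U) and G₁(U) are positive definite ((3.122), (3.128) are genuinely invertible); 𝔊(U)
is positive SEMI-definite and positive definite ON {A : QA = 0, RD*A = 0} — the repaired reading of `B9FrakGPos` (kernel
facts `not_posDef_frakG`, `frakG_pos_on_constraint`: the printed clause fails on range Q*, holds on the constraint surface
of the defining integral (3.148)). [cite: Balaban1985BackgroundPropagators, Thm 3.12 p.423, Thm 3.13 p.426, Thm 3.11 p.416, (3.148) p.425] -/
def PosDefKOfOps (𝔬 : Ops g B X Y Z W) : B9.KernelFamily g B → B.Cfg → Prop :=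
  fun _ U => PosDefEnd (𝔬.G U) ∧ PosDefEnd (𝔬.G1 U) ∧ (∀ f : X → ℝ, 0 ≤ f ⬝ᵥ 𝔬.GG U f) ∧
    ∀ f : X → ℝ, 𝔬.Q U f = 0 → 𝔬.R U (𝔬.Dvstar U f) = 0 → f ≠ 0 → 0 < f ⬝ᵥ 𝔬.GG U f

/-- **THE PIN OF `HasRWExp` — «Theorem 3.10 holds for the propagators G, G₁ [, 𝔊]»** in the located reading *"Of course
Theorem 3.10 holds also because we replace each operator in (3.130) by its random walk expansion"* (p. 422) ∕ *"Replacing the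
operators in (3.138) by their random walk expansions we get a random walk expansion for G₁"* (p. 423): the perturbation
series (3.130) converges to G(U), (3.138) to G₁(U), and 𝔓·(3.138) to 𝔊(U) = 𝔓G₁ ((3.153)), pointwise on the finite lattice.
The kernel-family and rate arguments are not read (the decay of the sums is the (3.42) part of the leaf; the inserted walks,
tree-like by p. 427, are the instance's — typed companion `B9SectDERandomWalkClauses.Thm312RWPrinted`).
[cite: Balaban1985BackgroundPropagators, Thm 3.12 p.423 + (3.130) p.421 + (3.138) p.423 + remark p.427] -/
def HasRWExpOfOps (𝔬 : Ops g B X Y Z W) : B9.KernelFamily g B → B.Cfg → ℝ → Prop :=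
  fun _ U _ => SeriesConv (𝔬.G0 U) (𝔬.Tpi U) (𝔬.G U) ∧ SeriesConv (𝔬.G0 U) (𝔬.Tpi U + 𝔬.T2 U) (𝔬.G1 U) ∧
    SeriesConvLR (𝔬.G0 U) (𝔬.Tpi U + 𝔬.T2 U) (frakP 𝔬 U) LinearMap.id (𝔬.GG U)

/-- **THE PIN OF `HasRWExpH` — «the inequality (3.133) together with Theorem 3.10 hold for the operators H, H₁»**, the
Theorem-3.10 half, located: H = GQ*(QGQ*)⁻¹ ((3.126)) with (3.130) inserted, H₁ = G₁Q*(QG₁Q*)⁻¹ ((3.129)) with (3.138)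
inserted, converge to H(U), H₁(U) pointwise (p. 423: *"From (3.129) and (3.132) with G₁ instead of G we get the inequalities
(3.133) for H₁"*; p. 427: *"We have the same situation for the operators H₁"*).  The H-kernel and rate arguments are not read.
[cite: Balaban1985BackgroundPropagators, Thm 3.12 p.423 + (3.126) p.420 + (3.129) p.421 + remark p.427] -/
def HasRWExpHOfOps (𝔬 : Ops g B X Y Z W) : B9.HKernel g B → B.Cfg → ℝ → Prop :=
  fun _ U _ => SeriesConvLR (𝔬.G0 U) (𝔬.Tpi U) LinearMap.id (𝔬.Qstar U ∘ₗ 𝔬.C U) (𝔬.Hm U) ∧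
    SeriesConvLR (𝔬.G0 U) (𝔬.Tpi U + 𝔬.T2 U) LinearMap.id (𝔬.Qstar U ∘ₗ 𝔬.C1 U) (𝔬.H1m U)

/-! ## §3 The hypothesis schemas (printed shape; nothing asserted) -/

variable [Fintype g.Site]

/-- **THE STATIC GEOMETRY AT ONE MEMBER**: the multiscale distance d of [4] (2.46) satisfies the triangle inequality (2.54),
is symmetric and non-negative, and every scale length L^jη is positive. [cite: Balaban1984PropagatorsII, (2.46) p.231 + (2.54) p.233; Balaban1985BackgroundPropagators, (3.41) p.397] -/
structure GeoOK (g : B9.Geometry) : Prop where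
  tri : ∀ a b c : g.Site, g.dist a c ≤ g.dist a b + g.dist b c
  symm : ∀ a b : g.Site, g.dist a b = g.dist b a
  dnn : ∀ a b : g.Site, 0 ≤ g.dist a b
  lenpos : ∀ y : g.Site, 0 < g.len y

/-- The weight (L^jη)^{−p} of the rescaled sup norm of §4 (the powers of (3.42) taken inside the size, `B9SectDSup` §1).
[cite: Balaban1985BackgroundPropagators, (3.42) p.397] -/
def wt (g : B9.Geometry) (p : ℕ) (y : g.Site) : ℝ := (g.len y ^ p)⁻¹

omit [Fintype X] [Fintype Z] [Fintype W] [Fintype g.Site] in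
/-- The weights (L^jη)^{−p} are non-negative when the scale lengths L^jη of (3.41) are. [cite: Balaban1985BackgroundPropagators, (3.41) p.397 (bookkeeping)] -/
theorem wt_nonneg (hlen : ∀ y : g.Site, 0 ≤ g.len y) (p : ℕ) (y : g.Site) : 0 ≤ wt g p y :=
  inv_nonneg.mpr (pow_nonneg (hlen y) p)

omit [Fintype X] [Fintype Z] [Fintype W] [Fintype g.Site] in
/-- L^jη ≧ 0 under `GeoOK` (the scale lengths of (3.41)). [cite: Balaban1985BackgroundPropagators, (3.41) p.397 (bookkeeping)] -/
theorem GeoOK.lenle (hG : GeoOK g) (y : g.Site) : 0 ≤ g.len y := (hG.lenpos y).le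

omit [Fintype X] [Fintype Z] [Fintype W] [Fintype g.Site] in
/-- The weights (L^jη)^{−p} are positive under `GeoOK`. [cite: Balaban1985BackgroundPropagators, (3.41) p.397 (bookkeeping)] -/
theorem wt_pos (hG : GeoOK g) (p : ℕ) (y : g.Site) : 0 < wt g p y :=
  inv_pos.mpr (pow_pos (hG.lenpos y) p)

/-- **THE STATE NORM 𝔠⁽ᵖ⁾**: the sharp-block sup size of the lattice `X` rescaled by (L^jη)^{−p} (`B9SectDSup.weightNorm` of
`B11SectG.BlockNorm.ofBlocks`): size of f near y = (L^jη)^{−p}·sup_{x∈Δ(y)}|f(x)|. [cite: Balaban1985BackgroundPropagators, (3.42) p.397; Balaban1984PropagatorsII, (2.51) p.232] -/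
def cNorm (R₀ : ℝ) (H₀ : Prop) (blk : X → g.Site) (hlen : ∀ y : g.Site, 0 ≤ g.len y) (p : ℕ) :
    BlockNorm (toB6 g R₀ H₀) (X → ℝ) :=
  weightNorm (BlockNorm.ofBlocks (toB6 g R₀ H₀) blk) (wt g p) (wt_nonneg hlen p)

omit [Fintype Z] [Fintype W] in
/-- The cutting cost of the state norm 𝔠⁽ᵖ⁾ is 1 (sharp blocks Δ(y) of [4] (2.52)). [cite: Balaban1984PropagatorsII, (2.51)–(2.52) p.232 (bookkeeping)] -/
@[simp] theorem cNorm_κ (R₀ : ℝ) (H₀ : Prop) (blk : X → g.Site) (hlen : ∀ y : g.Site, 0 ≤ g.len y) (p : ℕ) :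
    (cNorm R₀ H₀ blk hlen p (X := X)).κ = 1 := rfl

/-- **THEOREM 3.3 FOR G₀ AT THE CONFIGURATION U** (p. 399: *"the operator G(U) (a = 1) satisfies the inequalities
(3.42)–(3.47) … λ replaced by a function J defined at bonds"*; p. 421: G₀ = *"the operator we have investigated in previous
sections"*) — the two entries the right-entry glue consumes, in the [4]-(2.51) majorant shapes: (3.42)₁ |(G₀J)(x)| ≦
B₀(L^jη)²e^{−δ₀d(y,y′)}|J| and (3.42)₃ |(G₀∇*_UJ)(x)| ≦ B₀L^jη·e^{−δ₀d(y,y′)}|J| for x ∈ Δ(y), supp J ⊂ Δ(y′).  A HYPOTHESIS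
SCHEMA (Theorem 3.3 is the leaf `t31`∕`t33` of the knit, not asserted here). [cite: Balaban1985BackgroundPropagators, Thm 3.3 p.399 + (3.42) p.397] -/
structure Thm33G0 (𝔬 : Ops g B X Y Z W) (R₀ : ℝ) (H₀ : Prop) (B₀ δ₀ : ℝ) (U : B.Cfg) : Prop where
  e0 : HasMajorant (g := toB6 g R₀ H₀) 𝔬.blk (𝔬.G0 U)
    (fun (a b : g.Site) => B₀ * g.len a ^ 2 * Real.exp (-(δ₀ * g.dist a b)))
  e2 : HasMajorantHom (g := toB6 g R₀ H₀) 𝔬.blkY 𝔬.blk (𝔬.G0 U ∘ₗ 𝔬.Dstar U)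
    (fun (a b : g.Site) => B₀ * g.len a * Real.exp (-(δ₀ * g.dist a b)))

/-- **THE PERTURBATION STEPS OF (3.130) AND (3.138) IN THE STATE NORM 𝔠⁽ᵖ⁾**: K′ = G₀Δ′_π and K′₁ = G₀(Δ′_π + Δ⁽²⁾_π) have the
block majorant θ·e^{−δ_K d(y,y′)} between the rescaled sup sizes of weight (L^jη)^{−p}, i.e. sup_{Δ(y)}|G₀Δ′_πf| ≦
θ(L^jη∕L^{j′}η)ᵖ e^{−δ_K d(y,y′)} sup_{Δ(y′)}|f| for supp f ⊂ Δ(y′).  Print: *"It is easy to find estimates for the operator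
Δ′_π, using Theorem 3.1 and the inequality (3.49) … One of the three derivatives there has to be applied either to an
expression on the right, or on the left, of Δ′_π"* (p. 421), (3.131), *"This inequality and Theorem 3.3 for G₀ imply a
convergence of the series (3.130), for α₀ sufficiently small"* (p. 422), and for Δ⁽²⁾_π (3.137) + p. 423.  θ is O(1)·Mα₀
in print (*"each operator Δ′_π provides the small factor α₀"*).  A HYPOTHESIS SCHEMA; its matrix-level discharge over the
sharp-block sup norms is r06's `B9Thm312PositivityAssembled.hasMaj_G0_mul_step`. [cite: Balaban1985BackgroundPropagators, (3.130)–(3.131) pp.421–422 + (3.137)–(3.138) p.423] -/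
structure Step (𝔬 : Ops g B X Y Z W) (R₀ : ℝ) (H₀ : Prop) (hlen : ∀ y : g.Site, 0 ≤ g.len y) (p : ℕ)
    (θ δK : ℝ) (U : B.Cfg) : Prop where
  step : HasMaj (cNorm R₀ H₀ 𝔬.blk hlen p) (cNorm R₀ H₀ 𝔬.blk hlen p) (𝔬.G0 U ∘ₗ 𝔬.Tpi U)
    (fun a b => θ * Real.exp (-(δK * (toB6 g R₀ H₀).dist a b)))
  step1 : HasMaj (cNorm R₀ H₀ 𝔬.blk hlen p) (cNorm R₀ H₀ 𝔬.blk hlen p) (𝔬.G0 U ∘ₗ (𝔬.Tpi U + 𝔬.T2 U))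
    (fun a b => θ * Real.exp (-(δK * (toB6 g R₀ H₀).dist a b)))

/-- **THE RELATIVE FORM BOUND (N′) AND THEOREM 3.11 FOR Δ_a**: |⟨f, Δ′_πf⟩| ≦ r⟨f, Δ_af⟩ and |⟨f, (Δ′_π + Δ⁽²⁾_π)f⟩| ≦
r⟨f, Δ_af⟩ (the energy-norm smallness of the perturbation — p. 420 *"we will prove that this term is a small perturbation of
Δ_a"*, p. 423 *"the operators Δ⁽²⁾, Δ⁽²⁾_π are small in a proper sense"*; its derivation from (3.131), (3.137), Theorems
3.1∕3.3 and [4] Lemma 2.1 is `B9SectDForm` + the cell md), with Δ_a = G₀⁻¹ positive definite (Theorem 3.11 p. 416 for Δ_a).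
r is O(1)·Mα₀ in print.  A HYPOTHESIS SCHEMA. [cite: Balaban1985BackgroundPropagators, Thm 3.11 p.416, (3.120) p.419, (3.131) p.422, (3.137) p.423] -/
structure FormSmall (𝔬 : Ops g B X Y Z W) (r : ℝ) (U : B.Cfg) : Prop where
  posS0 : PosDefEnd (𝔬.S0 U)
  small : ∀ f : X → ℝ, |f ⬝ᵥ 𝔬.Tpi U f| ≤ r * (f ⬝ᵥ 𝔬.S0 U f)
  small1 : ∀ f : X → ℝ, |f ⬝ᵥ (𝔬.Tpi U + 𝔬.T2 U) f| ≤ r * (f ⬝ᵥ 𝔬.S0 U f)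

/-- **THE IDENTITIES OF SECT. D AT U** (hypotheses of printed shape, bundled; nothing asserted): G₀Δ_a = I (`invG0'`, G₀ =
Δ_a⁻¹, p. 421); (Δ_a − Δ′_π)G = I ((3.120) + (3.122), G⁻¹ = Δ_π + DRD* + Q*aQ = Δ_a − Δ′_π: `invG`) and (Δ_a − Δ′_π − Δ⁽²⁾_π)G₁ = I
((3.128), (3.134): `invG1`) — whence (3.130), (3.138) (`fix_of_inverses`; on a finite lattice the one-sided inverses are
two-sided, not needed); H = GQ*(QGQ*)⁻¹ ((3.126): `eq126`), H₁ = G₁Q*(QG₁Q*)⁻¹ ((3.129): `eq129`); 𝔊 = G₁𝔓* ((3.153):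
`eq153`); the p. 425 identities *"we need to know only the identities (3.124) and RD*G₁DR = R"*: (QG₁Q*)(QG₁Q*)⁻¹ = I
(`c1_inv`), QG₁DR = 0 (`h124Q`), RD*G₁Q* = 0 (`h124R`), RD*G₁DR = R (`hR`); and the adjointness ∕ symmetry print uses
tacitly: Q* is the adjoint of Q, D* of D (in DRD*), R is symmetric (`adjQ`, `adjDv`, `symmR`).
[cite: Balaban1985BackgroundPropagators, (3.120)–(3.130) pp.419–421, (3.147) p.425, (3.152)–(3.153) p.426] -/
structure Identities (𝔬 : Ops g B X Y Z W) (U : B.Cfg) : Prop where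
  invG0' : 𝔬.G0 U * 𝔬.S0 U = 1
  invG : (𝔬.S0 U - 𝔬.Tpi U) * 𝔬.G U = 1
  invG1 : (𝔬.S0 U - (𝔬.Tpi U + 𝔬.T2 U)) * 𝔬.G1 U = 1
  eq126 : 𝔬.Hm U = 𝔬.G U ∘ₗ 𝔬.Qstar U ∘ₗ 𝔬.C U
  eq129 : 𝔬.H1m U = 𝔬.G1 U ∘ₗ 𝔬.Qstar U ∘ₗ 𝔬.C1 U
  eq153 : 𝔬.GG U = 𝔬.G1 U ∘ₗ frakPstar 𝔬 U
  c1_inv : 𝔬.Q U ∘ₗ 𝔬.G1 U ∘ₗ 𝔬.Qstar U ∘ₗ 𝔬.C1 U = LinearMap.id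
  h124Q : 𝔬.Q U ∘ₗ 𝔬.G1 U ∘ₗ 𝔬.Dv U ∘ₗ 𝔬.R U = 0
  h124R : 𝔬.R U ∘ₗ 𝔬.Dvstar U ∘ₗ 𝔬.G1 U ∘ₗ 𝔬.Qstar U = 0
  hR : 𝔬.R U ∘ₗ 𝔬.Dvstar U ∘ₗ 𝔬.G1 U ∘ₗ 𝔬.Dv U ∘ₗ 𝔬.R U = 𝔬.R U
  adjQ : ∀ (f : X → ℝ) (b : Z → ℝ), 𝔬.Q U f ⬝ᵥ b = f ⬝ᵥ 𝔬.Qstar U b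
  adjDv : ∀ (s : W → ℝ) (f : X → ℝ), 𝔬.Dv U s ⬝ᵥ f = s ⬝ᵥ 𝔬.Dvstar U f
  symmR : ∀ s t : W → ℝ, 𝔬.R U s ⬝ᵥ t = s ⬝ᵥ 𝔬.R U t

end OneMember

end

end Literature.MathematicalPhysics.QuantumFieldTheory.Balaban1983to89.B9Thm312Whole
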